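import Summits.AtomisticToContinuum.BoseEinsteinCondensation.Theses.BECStronglyRayleigh
import Summits.AtomisticToContinuum.BoseEinsteinCondensation.Theorems.InsertionFieldDelocalisation.Negative.Toolkit
import Summits.AtomisticToContinuum.BoseEinsteinCondensation.Theorems.BECStronglyRayleighGroundStateStability
import Summits.AtomisticToContinuum.BoseEinsteinCondensation.Theorems.BECStronglyRayleighSectorGroundStatePerron
import Summits.AtomisticToContinuum.BoseEinsteinCondensation.Theorems.BECStronglyRayleighInsertionFieldDelocalisationTranslationInvariance
import HarnessLib

/-!
# Preliminaries for the amplitude-linear pinned void tail and the negative-dependence ceiling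
# (crux `BECStronglyRayleigh.InsertionFieldDelocalisation`, stmt-AtomisticToContinuum-9673)

Counting identities for coefficient families supported on `N`-sets (`lvt_sum_card_mul`,
`lvt_sum_sum_mem`, `lvt_sum_insert_insert`, `lvt_total_mass`, `lvt_inclusion_mass`), Theorem S on
the torus in real coefficient form (`lvt_amplitudes_stable`) and translation invariance of the
one-point sums `Σ_{S ∋ b} Re ψ(1_S)` (`lvt_onePoint_const`, from the landed
`stub_translationInvariance`). Used by `…LinearVoidTail` (line `mobile-trap-dirichlet-eigenfunction`)
and `…NACeiling` (the `M = N` form of the crux).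
-/

noncomputable section

namespace Summit.AtomisticToContinuum.BoseEinsteinCondensation.Cruxes.InsertionFieldDelocalisation.MobileTrapDirichletEigenfunction

open scoped BigOperators
open Literature.MathematicalPhysics.QuantumLattice Literature.Probability.LatticeModels Finset
open Summit.AtomisticToContinuum.BoseEinsteinCondensation.Theorems.InsertionFieldDelocalisation.Negative
  (field)

section Counting

variable {Λ : Type*} [Fintype Λ] [DecidableEq Λ]

omit [DecidableEq Λ] in
/-- `Σ_S |S|·a(S) = N·Σ_S a(S)` for a family supported on `N`-sets. [folklore] -/
theorem lvt_sum_card_mul (a : Finset Λ → ℝ) (N : ℕ) (ha : ∀ S, a S ≠ 0 → S.card = N) :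
    ∑ S : Finset Λ, (S.card : ℝ) * a S = N * ∑ S : Finset Λ, a S := by
  rw [Finset.mul_sum]
  refine Finset.sum_congr rfl fun S _ => ?_
  by_cases h : a S = 0
  · rw [h, mul_zero, mul_zero]
  · rw [ha S h]

/-- Double counting: `Σ_b Σ_{S ∋ b} a(S) = Σ_S |S|·a(S)`. [folklore] -/
theorem lvt_sum_sum_mem (a : Finset Λ → ℝ) :
    ∑ b : Λ, ∑ S ∈ univ.filter (fun S : Finset Λ => b ∈ S), a S = ∑ S : Finset Λ, (S.card : ℝ) * a S := by
  simp only [Finset.sum_filter]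
  rw [Finset.sum_comm]
  refine Finset.sum_congr rfl fun S _ => ?_
  rw [← Finset.sum_filter, Finset.sum_const, nsmul_eq_mul]
  congr 1
  rw [Finset.filter_mem_eq_inter, Finset.univ_inter]

/-- Reindexing the two-particle insertion sum at fixed `y ≠ x`:
`Σ_T [x,y ∉ T] a(T ∪ {x,y}) = Σ_{S ∋ x,y} a(S)`. [folklore] -/
theorem lvt_sum_insert_insert (a : Finset Λ → ℝ) {x y : Λ} (hxy : x ≠ y) :
    ∑ T : Finset Λ, (if x ∉ T ∧ y ∉ T then a (insert x (insert y T)) else 0) =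
      ∑ S ∈ univ.filter (fun S : Finset Λ => x ∈ S ∧ y ∈ S), a S := by
  rw [← Finset.sum_filter]
  refine Finset.sum_nbij' (fun T => insert x (insert y T)) (fun S => (S.erase x).erase y) ?_ ?_ ?_ ?_ ?_
  · intro T hT
    simp only [mem_filter, mem_univ, true_and] at hT ⊢
    exact ⟨mem_insert_self x _, mem_insert_of_mem (mem_insert_self y T)⟩
  · intro S hS
    simp only [mem_filter, mem_univ, true_and] at hS ⊢
    constructor
    · intro h
      exact (Finset.notMem_erase x S) (Finset.mem_of_mem_erase h)
    · exact Finset.notMem_erase y _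
  · intro T hT
    simp only [mem_filter, mem_univ, true_and] at hT
    rw [Finset.erase_insert, Finset.erase_insert hT.2]
    simp only [Finset.mem_insert, not_or]
    exact ⟨hxy, hT.1⟩
  · intro S hS
    simp only [mem_filter, mem_univ, true_and] at hS
    have hyS : y ∈ S.erase x := Finset.mem_erase.2 ⟨Ne.symm hxy, hS.2⟩
    rw [Finset.insert_erase hyS, Finset.insert_erase hS.1]
  · intro T _
    rfl

/-- **Total mass of the pinned two-particle field**: for `a` supported on `N`-sets,
`Σ_T r^T_x = (N-1)·Σ_{S ∋ x} a(S)` where `r^T_x = Σ_y [x,y ∉ T, x ≠ y] a(T ∪ {x,y})`. [folklore] -/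
theorem lvt_total_mass (a : Finset Λ → ℝ) (N : ℕ) (ha : ∀ S, a S ≠ 0 → S.card = N) (x : Λ) :
    ∑ T : Finset Λ, ∑ y : Λ, (if x ∉ T ∧ y ∉ T ∧ x ≠ y then a (insert x (insert y T)) else 0) =
      ((N : ℝ) - 1) * ∑ S ∈ univ.filter (fun S : Finset Λ => x ∈ S), a S := by
  rw [Finset.sum_comm]
  -- each `y ≠ x` contributes `Σ_{S ∋ x,y} a`, and `y = x` contributes `0`
  have hy : ∀ y : Λ, (∑ T : Finset Λ, if x ∉ T ∧ y ∉ T ∧ x ≠ y then a (insert x (insert y T)) else 0) =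
      if x ≠ y then ∑ S ∈ univ.filter (fun S : Finset Λ => x ∈ S ∧ y ∈ S), a S else 0 := by
    intro y
    by_cases hxy : x ≠ y
    · rw [if_pos hxy, ← lvt_sum_insert_insert a hxy]
      refine Finset.sum_congr rfl fun T _ => ?_
      by_cases h : x ∉ T ∧ y ∉ T
      · rw [if_pos ⟨h.1, h.2, hxy⟩, if_pos h]
      · rw [if_neg (fun h' => h ⟨h'.1, h'.2.1⟩), if_neg h]
    · rw [if_neg hxy]
      exact Finset.sum_eq_zero fun T _ => if_neg fun h => hxy h.2.2
  simp only [hy]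
  rw [← Finset.sum_filter]
  -- Σ_{y ≠ x} Σ_{S ∋ x,y} a S = Σ_{S ∋ x} (|S| - 1) a S
  have hswap : ∑ y ∈ univ.filter (fun y => x ≠ y), ∑ S ∈ univ.filter (fun S : Finset Λ => x ∈ S ∧ y ∈ S), a S =
      ∑ S ∈ univ.filter (fun S : Finset Λ => x ∈ S), ((S.card : ℝ) - 1) * a S := by
    simp only [Finset.sum_filter]
    have h2 : ∀ y : Λ, (if x ≠ y then ∑ S : Finset Λ, (if x ∈ S ∧ y ∈ S then a S else 0) else 0) =
        ∑ S : Finset Λ, (if x ≠ y then (if x ∈ S ∧ y ∈ S then a S else 0) else 0) := by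
      intro y
      split_ifs
      · rfl
      · simp
    simp only [h2]
    rw [Finset.sum_comm]
    refine Finset.sum_congr rfl fun S _ => ?_
    by_cases hxS : x ∈ S
    · rw [if_pos hxS]
      have h1 : ∀ y : Λ, (if x ≠ y then (if x ∈ S ∧ y ∈ S then a S else 0) else 0) =
          if y ∈ S.erase x then a S else 0 := by
        intro y
        by_cases hxy : x ≠ y
        · rw [if_pos hxy]
          by_cases hyS : y ∈ S
          · rw [if_pos ⟨hxS, hyS⟩, if_pos (Finset.mem_erase.2 ⟨Ne.symm hxy, hyS⟩)]
          · rw [if_neg (fun h => hyS h.2), if_neg (fun h => hyS (Finset.mem_of_mem_erase h))]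
        · rw [if_neg hxy, if_neg]
          intro h
          exact hxy (Ne.symm (Finset.mem_erase.1 h).1)
      simp only [h1]
      rw [← Finset.sum_filter, Finset.filter_mem_eq_inter, Finset.univ_inter, Finset.sum_const,
        nsmul_eq_mul, Finset.card_erase_of_mem hxS, Nat.cast_sub (Finset.card_pos.2 ⟨x, hxS⟩)]
      simp
    · rw [if_neg hxS]
      refine Finset.sum_eq_zero fun y _ => ?_
      rw [if_neg (fun h : x ∈ S ∧ y ∈ S => hxS h.1)]
      split_ifs <;> rfl
  rw [hswap, Finset.mul_sum]
  refine Finset.sum_congr rfl fun S hS => ?_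
  by_cases h : a S = 0
  · rw [h, mul_zero, mul_zero]
  · rw [ha S h]

/-- **Inclusion mass of the pinned two-particle field**: for `a` supported on `N`-sets and
`b ≠ x`, `Σ_{T ∋ b} r^T_x = (N-2)·Σ_{S ∋ x,b} a(S)`. [folklore] -/
theorem lvt_inclusion_mass (a : Finset Λ → ℝ) (N : ℕ) (ha : ∀ S, a S ≠ 0 → S.card = N) {x b : Λ}
    (hxb : x ≠ b) :
    ∑ T ∈ univ.filter (fun T : Finset Λ => b ∈ T), ∑ y : Λ,
        (if x ∉ T ∧ y ∉ T ∧ x ≠ y then a (insert x (insert y T)) else 0) =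
      ((N : ℝ) - 2) * ∑ S ∈ univ.filter (fun S : Finset Λ => x ∈ S ∧ b ∈ S), a S := by
  rw [Finset.sum_filter]
  have h0 : ∀ T : Finset Λ, (if b ∈ T then ∑ y : Λ,
      (if x ∉ T ∧ y ∉ T ∧ x ≠ y then a (insert x (insert y T)) else 0) else 0) =
      ∑ y : Λ, (if b ∈ T then (if x ∉ T ∧ y ∉ T ∧ x ≠ y then a (insert x (insert y T)) else 0) else 0) := by
    intro T
    split_ifs
    · rfl
    · simp
  simp only [h0]
  rw [Finset.sum_comm]
  -- push the indicator `b ∈ T` inside and reindex at fixed `y`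
  have hy : ∀ y : Λ, (∑ T : Finset Λ, if b ∈ T then
      (if x ∉ T ∧ y ∉ T ∧ x ≠ y then a (insert x (insert y T)) else 0) else 0) =
      if x ≠ y ∧ b ≠ y then ∑ S ∈ univ.filter (fun S : Finset Λ => (x ∈ S ∧ y ∈ S) ∧ b ∈ S), a S else 0 := by
    intro y
    by_cases hc : x ≠ y ∧ b ≠ y
    · have e : (∑ S ∈ univ.filter (fun S : Finset Λ => (x ∈ S ∧ y ∈ S) ∧ b ∈ S), a S) =
          ∑ S ∈ univ.filter (fun S : Finset Λ => x ∈ S ∧ y ∈ S), (if b ∈ S then a S else 0) := by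
        rw [Finset.sum_filter, Finset.sum_filter]
        refine Finset.sum_congr rfl fun S _ => ?_
        by_cases h1 : x ∈ S ∧ y ∈ S <;> by_cases h2 : b ∈ S <;> simp [h1, h2]
      rw [if_pos hc, e, ← lvt_sum_insert_insert (fun S => if b ∈ S then a S else 0) hc.1]
      refine Finset.sum_congr rfl fun T _ => ?_
      by_cases hbT : b ∈ T
      · rw [if_pos hbT]
        by_cases h : x ∉ T ∧ y ∉ T
        · rw [if_pos ⟨h.1, h.2, hc.1⟩, if_pos h, if_pos]
          exact Finset.mem_insert_of_mem (Finset.mem_insert_of_mem hbT)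
        · rw [if_neg (fun h' => h ⟨h'.1, h'.2.1⟩), if_neg h]
      · rw [if_neg hbT]
        by_cases h : x ∉ T ∧ y ∉ T
        · rw [if_pos h, if_neg]
          simp only [Finset.mem_insert, not_or]
          exact ⟨Ne.symm hxb, hc.2, hbT⟩
        · rw [if_neg h]
    · rw [if_neg hc]
      refine Finset.sum_eq_zero fun T _ => ?_
      by_cases hbT : b ∈ T
      · rw [if_pos hbT]
        rw [if_neg]
        rintro ⟨-, hyT, hxy⟩
        apply hc
        exact ⟨hxy, fun hby => hyT (hby ▸ hbT)⟩
      · rw [if_neg hbT]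
  simp only [hy]
  -- Σ_{y ∉ {x,b}} Σ_{S ∋ x,y,b} a S = Σ_{S ∋ x,b} (|S| - 2) a S
  have h2 : ∀ y : Λ, (if x ≠ y ∧ b ≠ y then
      ∑ S ∈ univ.filter (fun S : Finset Λ => (x ∈ S ∧ y ∈ S) ∧ b ∈ S), a S else 0) =
      ∑ S : Finset Λ, (if x ∈ S ∧ b ∈ S then (if y ∈ (S.erase x).erase b then a S else 0) else 0) := by
    intro y
    by_cases hc : x ≠ y ∧ b ≠ y
    · rw [if_pos hc, Finset.sum_filter]
      refine Finset.sum_congr rfl fun S _ => ?_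
      by_cases hxbS : x ∈ S ∧ b ∈ S
      · rw [if_pos hxbS]
        by_cases hyS : y ∈ S
        · rw [if_pos ⟨⟨hxbS.1, hyS⟩, hxbS.2⟩, if_pos]
          exact Finset.mem_erase.2 ⟨Ne.symm hc.2, Finset.mem_erase.2 ⟨Ne.symm hc.1, hyS⟩⟩
        · rw [if_neg (fun h => hyS h.1.2), if_neg]
          exact fun h => hyS (Finset.mem_of_mem_erase (Finset.mem_of_mem_erase h))
      · rw [if_neg hxbS, if_neg]
        exact fun h => hxbS ⟨h.1.1, h.2⟩
    · rw [if_neg hc]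
      symm
      refine Finset.sum_eq_zero fun S _ => ?_
      split_ifs with hxbS hyS
      · exfalso
        apply hc
        have h1 := Finset.mem_erase.1 hyS
        have h2 := Finset.mem_erase.1 h1.2
        exact ⟨Ne.symm h2.1, Ne.symm h1.1⟩
      · rfl
      · rfl
  simp only [h2]
  rw [Finset.sum_comm, Finset.sum_filter, Finset.mul_sum]
  refine Finset.sum_congr rfl fun S _ => ?_
  by_cases hxbS : x ∈ S ∧ b ∈ S
  · simp only [if_pos hxbS]
    rw [← Finset.sum_filter, Finset.filter_mem_eq_inter, Finset.univ_inter, Finset.sum_const,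
      nsmul_eq_mul, Finset.card_erase_of_mem (Finset.mem_erase.2 ⟨Ne.symm hxb, hxbS.2⟩),
      Finset.card_erase_of_mem hxbS.1]
    by_cases h : a S = 0
    · rw [h, mul_zero, mul_zero]
    · rw [ha S h]
      have hN : 2 ≤ N := by
        rw [← ha S h]
        exact Finset.one_lt_card.2 ⟨x, hxbS.1, b, hxbS.2, hxb⟩
      rw [Nat.cast_sub (by omega), Nat.cast_sub (by omega)]
      push_cast
      ring
  · simp only [if_neg hxbS]
    simp

end Counting

section Torus

open Summit.AtomisticToContinuum.BoseEinsteinCondensation.Cruxes.InsertionFieldDelocalisation.LogInsertionInfraredBound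
  (stub_translationInvariance)

/-- **Theorem S on the torus, real coefficient form**: for an admissible datum of the crux, the
occupation amplitudes `a(S) = Re ψ(1_S)` have a generating polynomial with no zero in `H^Λ`
(`GroundStateStability_proof` with `G = torusGraph 3 L`, `Δ = 0`, `μ = 0`). [folklore] -/
theorem lvt_amplitudes_stable (L : ℕ) [NeZero L] {N : ℕ}
    {ψ : TensorIndex (TorusSite 3 L) 2 → ℂ}
    (hψK : ψ ∈ spinZSector 1 ((N : ℝ) - (L : ℝ) ^ 3 / 2)) (hψ0 : ψ ≠ 0)
    (hH : (xyTorus 3 L 1).mulVec ψ =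
      ((lowestEnergyInSector 1 (xyTorus 3 L 1) ((N : ℝ) - (L : ℝ) ^ 3 / 2) : ℝ) : ℂ) • ψ)
    (hnn : ∀ σ, 0 ≤ (ψ σ).re ∧ (ψ σ).im = 0) :
    ∀ z : TorusSite 3 L → ℂ, (∀ i, 0 < (z i).im) →
      (∑ S : Finset (TorusSite 3 L),
        (((ψ (fun i => if i ∈ S then 0 else 1)).re : ℝ) : ℂ) * ∏ i ∈ S, z i) ≠ 0 := by
  intro z hz
  have hS := Summit.AtomisticToContinuum.BoseEinsteinCondensation.Theorems.GroundStateStability_proof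
    (TorusSite 3 L) (torusGraph 3 L)
    (Summit.AtomisticToContinuum.BoseEinsteinCondensation.Theorems.BECStronglyRayleighSectorPerron.torusGraph_connected 3 L)
    0 (fun _ => (0 : ℝ)) (by norm_num) ((N : ℝ) - (L : ℝ) ^ 3 / 2) ψ hψK hψ0
  simp only [Complex.ofReal_zero, zero_smul, Finset.sum_const_zero, add_zero] at hS
  have key := hS hH z hz
  have hre : ∀ S : Finset (TorusSite 3 L),
      (((ψ (fun i => if i ∈ S then 0 else 1)).re : ℝ) : ℂ) = ψ (fun i => if i ∈ S then 0 else 1) :=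
    fun S => Complex.ext (by simp) (by simp [(hnn _).2])
  simp only [hre]
  exact key

/-- **One-point sums are translation invariant**: for an admissible datum of the crux,
`Σ_{S ∋ b} Re ψ(1_S)` does not depend on the site `b` (translation invariance of `ψ`,
`stub_translationInvariance`, and the relabelling `S ↦ S + (b' - b)`). [folklore] -/
theorem lvt_onePoint_const (L : ℕ) [NeZero L] (hL : 2 ≤ L) {N : ℕ} (hN : 2 ≤ N) (hNL : 2 * N ≤ L ^ 3)
    {ψ : TensorIndex (TorusSite 3 L) 2 → ℂ}
    (hψK : ψ ∈ spinZSector 1 ((N : ℝ) - (L : ℝ) ^ 3 / 2)) (hψ0 : ψ ≠ 0)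
    (hH : (xyTorus 3 L 1).mulVec ψ =
      ((lowestEnergyInSector 1 (xyTorus 3 L 1) ((N : ℝ) - (L : ℝ) ^ 3 / 2) : ℝ) : ℂ) • ψ)
    (hnn : ∀ σ, 0 ≤ (ψ σ).re ∧ (ψ σ).im = 0) (b b' : TorusSite 3 L) :
    ∑ S ∈ univ.filter (fun S : Finset (TorusSite 3 L) => b ∈ S), (ψ (fun i => if i ∈ S then 0 else 1)).re =
      ∑ S ∈ univ.filter (fun S : Finset (TorusSite 3 L) => b' ∈ S),
        (ψ (fun i => if i ∈ S then 0 else 1)).re := by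
  have hTI := stub_translationInvariance L hL N hN hNL ψ hψK hψ0 hH hnn
  set d : TorusSite 3 L := b' - b with hd
  refine Finset.sum_nbij' (fun S => S.map (Equiv.addRight d).toEmbedding)
    (fun S => S.map (Equiv.addRight (-d)).toEmbedding) ?_ ?_ ?_ ?_ ?_
  · intro S hS
    simp only [mem_filter, mem_univ, true_and] at hS ⊢
    rw [Finset.mem_map_equiv]
    have : (Equiv.addRight d).symm b' = b := by
      rw [Equiv.addRight_symm]
      show b' + -d = b
      rw [hd]; abel
    rw [this]
    exact hS
  · intro S hS
    simp only [mem_filter, mem_univ, true_and] at hS ⊢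
    rw [Finset.mem_map_equiv]
    have : (Equiv.addRight (-d)).symm b = b' := by
      rw [Equiv.addRight_symm]
      show b + - -d = b'
      rw [hd]; abel
    rw [this]
    exact hS
  · intro S _
    rw [Finset.map_map]
    convert Finset.map_refl (s := S)
    ext x
    simp
  · intro S _
    rw [Finset.map_map]
    convert Finset.map_refl (s := S)
    ext x
    simp
  · intro S _
    -- `1_{S + d} = 1_S ∘ (· - d)`, and `ψ` is invariant under `σ ↦ σ ∘ (· + (-d))`
    have key := hTI (-d) (fun j => if j ∈ S then (0 : Fin 2) else 1)
    have hind : (fun i : TorusSite 3 L => if i ∈ S.map (Equiv.addRight d).toEmbedding then (0 : Fin 2) else 1) =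
        fun i => if i + -d ∈ S then (0 : Fin 2) else 1 := by
      funext i
      have hiff : i ∈ S.map (Equiv.addRight d).toEmbedding ↔ i + -d ∈ S := by
        rw [Finset.mem_map_equiv, Equiv.addRight_symm]
        rfl
      by_cases h : i + -d ∈ S
      · rw [if_pos (hiff.2 h), if_pos h]
      · rw [if_neg (fun h' => h (hiff.1 h')), if_neg h]
    rw [hind]
    exact (congrArg Complex.re key).symm

end Torus

section Registered

/-- **Registered handle** (stub form, `--supports stmt-AtomisticToContinuum-9673`): translation
invariance of the one-point sums `Σ_{S ∋ b} Re ψ(1_S)` for an admissible datum of the crux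
(`lvt_onePoint_const`). [folklore] -/
theorem stub_onePointTranslationInvariance :
    ∀ (L : ℕ) [NeZero L], 2 ≤ L → ∀ N : ℕ, 2 ≤ N → 2 * N ≤ L ^ 3 →
      ∀ ψ : TensorIndex (TorusSite 3 L) 2 → ℂ,
        ψ ∈ spinZSector 1 ((N : ℝ) - (L : ℝ) ^ 3 / 2) → ψ ≠ 0 →
        (xyTorus 3 L 1).mulVec ψ =
          ((lowestEnergyInSector 1 (xyTorus 3 L 1) ((N : ℝ) - (L : ℝ) ^ 3 / 2) : ℝ) : ℂ) • ψ →
        (∀ σ, 0 ≤ (ψ σ).re ∧ (ψ σ).im = 0) →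
        ∀ b b' : TorusSite 3 L,
          ∑ S ∈ Finset.univ.filter (fun S : Finset (TorusSite 3 L) => b ∈ S),
              (ψ (fun i => if i ∈ S then 0 else 1)).re =
            ∑ S ∈ Finset.univ.filter (fun S : Finset (TorusSite 3 L) => b' ∈ S),
              (ψ (fun i => if i ∈ S then 0 else 1)).re :=
  fun L _ hL _N hN hNL _ψ hψK hψ0 hH hnn b b' => lvt_onePoint_const L hL hN hNL hψK hψ0 hH hnn b b'

end Registered

end Summit.AtomisticToContinuum.BoseEinsteinCondensation.Cruxes.InsertionFieldDelocalisation.MobileTrapDirichletEigenfunction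

end
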